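import Summits.QuantumAdvantage.QuantumAdvantage.Theorems.CubicForrelationSignedExactCubicForrelationNotPrBPPGrowMachineSpans

/-!
# Crux `CubicForrelation.SignedExactCubicForrelationNotPrBPP` (stmt-QuantumAdvantage-13932), line `dual-pingpong-frame`
# (GROW reshape): the GROW machine, V–VI — the checks are sound and complete; the candidate space and its uniform law

Proof-only support file (`--supports stmt-QuantumAdvantage-13932`) toward the registered stub `stub_growFinder`; sequel
of `…GrowMachineSpec.lean` / `…GrowMachineSpans.lean`. For a function `g` of degree `≤ 3` handed over as a circuit code `cg`, with the line's
closedness predicate written as a parameter `Cl` (`hCl`: `Cl A B` iff every slice row `k ↦ T(s, y, e_k)`, `s ∈ A`, lies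
in `B`, and every offset `r ↦ D_s D_r g (0)` restricted to `rad B_s` is the inner product with some `ℓ ∈ B`):

* `bd_dualOf_eq` — the machine's offset vector `dualOf` solves `ℓ · r = D_s D_r g (0)` on the kernel of the rows it
  was solved on (dual vectors, `F2Elim.dotZ_dualVec_eq`; the offset is additive there by the cocycle law);
* `lamOf_subset` — if `Cl V W` for subspaces and the rows of `S` lie in `V`, every generator of `Λ_g(S)` lies in `W`
  (rows: the closedness clause at `y = eᵢ`; offsets: the machine's solution and the promised `ℓ ∈ W` agree on the
  common kernel, so they differ by a vector of the row space of the slices, which is inside `W`);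
* `closedChk_sound` — **the closedness check certifies `Cl (span S) (span U)`** (span induction: rows are bilinear,
  offsets additive up to third differences that vanish on the common kernel; the upgrade from the common kernel to
  `rad B_s` is `MPair.exists_repr_of_additive` plus the same row-space correction);
* `closedChk_complete` — conversely `Cl (span S) (span U)` passes the check; `orthChk_iff` — the orthogonality check is
  orthogonality of the spans;
* `bz_mem_kerSet_candK_iff` — **the kernel of the candidate rows `candK n cg S U xs` is the candidate space of the
  line** (`v ∈ Z_g(S)`, `v ⊥ span U`, `v ∈ rad B_x` for every probe); `card_filter_kcV_mem` / `card_filter_kcV_div` —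
  **the candidate is uniform on it**: the selectors whose kernel combination lands in `G` number `2^{#pivots} · |K ∩ G|`.

## References

* C. Carlet, *Boolean Functions for Cryptography and Coding Theory*, CUP 2021, §2.2.2, Prop. 54. [Carlet2020]
* J. von zur Gathen, J. Gerhard, *Modern Computer Algebra*, 3rd ed., CUP 2013, §12.1. [VonzurgathenGerhard2013]
* R. O'Donnell, *Analysis of Boolean Functions*, CUP 2014, §3.3. [ODonnell2014]
-/

noncomputable section

set_option linter.dupNamespace false -- D-0017: single-problem summit ⇒ `QuantumAdvantage.QuantumAdvantage` by design

namespace Summit.QuantumAdvantage.QuantumAdvantage.Theorems.SignedExactCubicForrelationNotPrBPP.GrowMachine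

open Finset
open Literature.Computability.Complexity Literature.Computability.QuantumComplexity
open Literature.Computability.Complexity.F2Elim
open Literature.Computability.Complexity.BLR (toZ toZ_xor toZ_and toZ_injective)
open Literature.Computability.QuantumComplexity.BuzetChailloux (bxor zeroVec bxor_self bxor_comm bxor_zeroVec zeroVec_bxor
  bxor_bxor_cancel_left)
open PolarGeometry (toZ_bdot bdot_comm bdot_bxor_left bdot_bxor_right bxor_bxor_swap bxor_bxor_assoc)
open NoTrap (bdot_zeroVec bdot_unit D_symm D_bxor_left D_zeroVec_eq D3_swap D3_basefree D3_bxor D3_repr)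
open ForrCode QuadSampler MMReadout
open FinderMachine (Vec Mat normV basisOf kerOf inSpan)

variable {n : ℕ}

variable {g : (Fin n → Bool) → Bool} (D : (Fin n → Bool) → (Fin n → Bool) → (Fin n → Bool) → Bool)
  (hD : ∀ u v x, D u v x = (g x ^^ g (bxor x u) ^^ g (bxor x v) ^^ g (bxor x (bxor u v))))
  {cg : PCirc} (hg : ∀ v, evalP cg v = g (toInput n v)) (hg3 : IsDegLeFun 3 g)

/-! ### The machine's offset vector solves the offset equations on the kernel -/

section Dual
include hD hg

/-- **The dual vector solves the offset equations on the kernel.** If `T(s, r, ·) = 0` for every `r` in the kernel of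
`A` (the kernel lies in `rad B_s`), then the machine's offset vector `ℓ = dualOf n cg s (rrun n (kerOf n A))` satisfies
`ℓ · r = D_s D_r g (0)` for every such `r`. [cite: VonzurgathenGerhard2013, §12.1] -/
theorem bd_dualOf_eq (s : List Bool) (A : Mat)
    (hA : ∀ r : Fin n → Bool, bz r ∈ kerSet n A → ∀ y, (D (toInput n s) r zeroVec ^^ D (toInput n s) r y) = false)
    (r : Fin n → Bool) (hr : bz r ∈ kerSet n A) :
    (univ.filter fun i => toInput n (dualOf n cg s (rrun n (kerOf n A))) i && r i).card.bodd = D (toInput n s) r zeroVec := by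
  have hker : ∀ u : Fin n → ZMod 2, u ∈ rowSpan n (kerOf n A) → bz (zb u) ∈ kerSet n A := fun u hu =>
    (mem_spanV_kerOf_iff A (zb u)).1 ((mem_spanV (zb u)).2 (by rwa [bz_zb]))
  have h0 : (fun t : Fin n → ZMod 2 => toZ (D (toInput n s) (zb t) zeroVec)) 0 = 0 := by
    show toZ (D (toInput n s) (zb 0) zeroVec) = 0
    rw [zb_zero, show (zeroV : Fin n → Bool) = zeroVec from rfl, D_zero_right D hD]; rfl
  have hadd : ∀ u ∈ rowSpan n (kerOf n A), ∀ v ∈ rowSpan n (kerOf n A),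
      (fun t : Fin n → ZMod 2 => toZ (D (toInput n s) (zb t) zeroVec)) (u + v) =
        (fun t : Fin n → ZMod 2 => toZ (D (toInput n s) (zb t) zeroVec)) u + (fun t : Fin n → ZMod 2 => toZ (D (toInput n s) (zb t) zeroVec)) v := by
    intro u hu v _
    show toZ (D (toInput n s) (zb (u + v)) zeroVec) = toZ (D (toInput n s) (zb u) zeroVec) + toZ (D (toInput n s) (zb v) zeroVec)
    rw [zb_add, show LowDegree.xorVec (zb u) (zb v) = bxor (zb u) (zb v) from rfl, D0_bxor_right D hD,
      hA (zb u) (hker u hu) (zb v), Bool.xor_false, toZ_xor]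
  have hv : bz r ∈ rowSpan n (kerOf n A) := (mem_spanV r).1 ((mem_spanV_kerOf_iff A r).2 hr)
  have key := dotZ_dualVec_eq (M := kerOf n A) (fun t : Fin n → ZMod 2 => toZ (D (toInput n s) (zb t) zeroVec)) h0 hadd hv
  apply toZ_injective
  rw [toZ_bd, bz_toInput_dualOf D hD hg]
  refine key.trans ?_
  show toZ (D (toInput n s) (zb (bz r)) zeroVec) = _
  rw [zb_bz]

end Dual

/-! ### Closed pairs: the generators of `Λ` stay inside -/

variable (Cl : Finset (Fin n → Bool) → Finset (Fin n → Bool) → Prop)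
  (hCl : ∀ A B, Cl A B ↔
    ((∀ s ∈ A, ∀ y : Fin n → Bool, (fun k => (D s y zeroVec ^^ D s y (fun j => decide (j = k)))) ∈ B) ∧
     (∀ s ∈ A, ∃ ℓ ∈ B, ∀ r : Fin n → Bool, (∀ y z : Fin n → Bool, (D s r z ^^ D s r (bxor z y)) = false) →
        D s r zeroVec = (univ.filter fun i => ℓ i && r i).card.bodd)))

section Closed
include hD hg hg3 hCl

omit hCl in
/-- The kernel of the stacked slices of `S` lies in `rad B_s` for every row `s` of `S` (degree `≤ 3`). [cite: Carlet2020, §2.2.2] -/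
theorem ker_stackOf_sub_rad {S : Mat} {s : List Bool} (hs : s ∈ S) (A : Mat) (hA : ∀ d, d ∈ kerSet n A → d ∈ kerSet n (stackOf n cg S))
    (r : Fin n → Bool) (hr : bz r ∈ kerSet n A) : ∀ y, (D (toInput n s) r zeroVec ^^ D (toInput n s) r y) = false :=
  ((bz_mem_kerSet_stackOf_iff D hD hg hg3 S r).1 (hA _ hr)) s hs

omit hCl hg3 in
/-- The rows of the stacked slices of `S` lie in `W` when the rows clause holds on `V ⊇ S`. [cite: Carlet2020, Prop. 54] -/
theorem stackOf_rows_mem {V W : Finset (Fin n → Bool)}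
    (hrows : ∀ s ∈ V, ∀ y : Fin n → Bool, (fun k => (D s y zeroVec ^^ D s y (fun j => decide (j = k)))) ∈ W)
    {S : Mat} (hS : ∀ s ∈ S, toInput n s ∈ V) {x : List Bool} (hx : x ∈ stackOf n cg S) : toInput n x ∈ W := by
  obtain ⟨s, hs, i, rfl⟩ := mem_stackOf_iff.1 hx
  rw [toInput_rowOf D hD hg, toInput_unitL]
  exact hrows _ (hS s hs) _

/-- **Generators of `Λ_g(S)` stay in `W`** when `Cl V W`, `W` is a subspace and the rows of `S` lie in `V`.
[cite: Carlet2020, Prop. 54] -/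
theorem lamOf_subset {V W : Finset (Fin n → Bool)} (hW0 : zeroVec ∈ W) (hWadd : ∀ x ∈ W, ∀ y ∈ W, bxor x y ∈ W)
    (hVW : Cl V W) {S : Mat} (hS : ∀ s ∈ S, toInput n s ∈ V) : ∀ x ∈ lamOf n cg S, toInput n x ∈ W := by
  obtain ⟨hrows, hoffs⟩ := (hCl V W).1 hVW
  intro x hx
  rcases List.mem_append.1 hx with hx | hx
  · exact stackOf_rows_mem D hD hg hrows hS hx
  · obtain ⟨s, hs, rfl⟩ := List.mem_map.1 hx
    -- the promised representative `ℓ' ∈ W` and the machine's `ℓ` agree on the common kernel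
    obtain ⟨ℓ', hℓ'W, hℓ'⟩ := hoffs _ (hS s hs)
    set ℓ := toInput n (dualOf n cg s (rrun n (kerOf n (stackOf n cg S)))) with hℓ
    have hrad := ker_stackOf_sub_rad D hD hg hg3 (S := S) hs (stackOf n cg S) (fun _ h => h)
    have hagree : ∀ r : Fin n → Bool, bz r ∈ kerSet n (stackOf n cg S) →
        (univ.filter fun i => bxor ℓ ℓ' i && r i).card.bodd = false := by
      intro r hr
      rw [bdot_bxor_left, hℓ, bd_dualOf_eq D hD hg s _ hrad r hr, ← hℓ' r ((inRad_iff D hD hg3 _ r).2 (hrad r hr)), Bool.xor_self]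
    have hdiff : bxor ℓ ℓ' ∈ W :=
      spanV_subset_of_rows hW0 hWadd (fun x hx => stackOf_rows_mem D hD hg hrows hS hx) (mem_spanV_of_orth_ker hagree)
    have : ℓ = bxor (bxor ℓ ℓ') ℓ' := by
      show ℓ = (ℓ + ℓ') + ℓ'
      rw [add_assoc, show ℓ' + ℓ' = 0 from bxor_self ℓ', add_zero]
    rw [this]
    exact hWadd _ hdiff _ hℓ'W

/-- **Completeness of the closedness check**: a pair whose spans are closed passes the check. [cite: Carlet2020, Prop. 54] -/
theorem closedChk_complete {S U : Mat} (h : Cl (spanV n S) (spanV n U)) : closedChk n cg S U = true := by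
  rw [closedChk, List.all_eq_true]
  intro x hx
  exact (inSpan_eq_true_iff U x).2 (lamOf_subset D hD hg hg3 Cl hCl (zeroVec_mem_spanV U) (fun _ hx _ hy => bxor_mem_spanV hx hy) h
    (fun s hs => toInput_mem_spanV hs) x hx)

/-- **Soundness of the closedness check**: if every generator of `Λ_g(S)` lies in `span U`, then
`Cl (span S) (span U)`. [cite: Carlet2020, Prop. 54] -/
theorem closedChk_sound {S U : Mat} (h : closedChk n cg S U = true) : Cl (spanV n S) (spanV n U) := by
  rw [closedChk, List.all_eq_true] at h
  have hmem : ∀ x ∈ lamOf n cg S, toInput n x ∈ spanV n U := fun x hx => (inSpan_eq_true_iff U x).1 (h x hx)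
  have hrowsS : ∀ s ∈ S, ∀ i : Fin n, (fun k => (D (toInput n s) (fun j => decide (j = i)) zeroVec ^^
      D (toInput n s) (fun j => decide (j = i)) (fun j => decide (j = k)))) ∈ spanV n U := by
    intro s hs i
    have hx := hmem _ (List.mem_append_left _ (mem_stackOf_iff.2 ⟨s, hs, i, rfl⟩))
    rwa [toInput_rowOf D hD hg, toInput_unitL] at hx
  -- rows: bilinearity and span induction twice
  have hrows : ∀ s ∈ spanV n S, ∀ y : Fin n → Bool, (fun k => (D s y zeroVec ^^ D s y (fun j => decide (j = k)))) ∈ spanV n U := by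
    refine spanV_induction (P := fun s => ∀ y : Fin n → Bool, (fun k => (D s y zeroVec ^^ D s y (fun j => decide (j = k)))) ∈ spanV n U)
      (fun y => ?_) (fun s hs => ?_) (fun a b ha hb y => ?_)
    · have : (fun k => (D zeroVec y zeroVec ^^ D zeroVec y (fun j => decide (j = k)))) = (zeroVec : Fin n → Bool) :=
        funext fun k => T_zero_left D hD y _
      rw [this]; exact zeroVec_mem_spanV U
    · refine unit_induction ?_ (hrowsS s hs) (fun a b ha hb => ?_)
      · have : (fun k => (D (toInput n s) zeroVec zeroVec ^^ D (toInput n s) zeroVec (fun j => decide (j = k)))) = (zeroVec : Fin n → Bool) :=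
          funext fun k => by rw [D_zero_right D hD, D_zero_right D hD]; rfl
        rw [this]; exact zeroVec_mem_spanV U
      · have : (fun k => (D (toInput n s) (bxor a b) zeroVec ^^ D (toInput n s) (bxor a b) (fun j => decide (j = k)))) =
            bxor (fun k => (D (toInput n s) a zeroVec ^^ D (toInput n s) a (fun j => decide (j = k))))
              (fun k => (D (toInput n s) b zeroVec ^^ D (toInput n s) b (fun j => decide (j = k)))) :=
          funext fun k => T_bxor2 D hD hg3 _ a b _
        rw [this]; exact bxor_mem_spanV ha hb
    · have : (fun k => (D (bxor a b) y zeroVec ^^ D (bxor a b) y (fun j => decide (j = k)))) =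
          bxor (fun k => (D a y zeroVec ^^ D a y (fun j => decide (j = k)))) (fun k => (D b y zeroVec ^^ D b y (fun j => decide (j = k)))) :=
        funext fun k => T_bxor1 D hD hg3 a b y _
      rw [this]; exact bxor_mem_spanV (ha y) (hb y)
  refine (hCl _ _).2 ⟨hrows, ?_⟩
  -- offsets on the common kernel `K` of the stacked slices, by span induction
  set A := stackOf n cg S with hA
  have hQ : ∀ s ∈ spanV n S, (∀ r : Fin n → Bool, bz r ∈ kerSet n A → ∀ y, (D s r zeroVec ^^ D s r y) = false) ∧
      ∃ ℓ ∈ spanV n U, ∀ r : Fin n → Bool, bz r ∈ kerSet n A → D s r zeroVec = (univ.filter fun i => ℓ i && r i).card.bodd := by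
    refine spanV_induction (P := fun s => (∀ r : Fin n → Bool, bz r ∈ kerSet n A → ∀ y, (D s r zeroVec ^^ D s r y) = false) ∧
      ∃ ℓ ∈ spanV n U, ∀ r : Fin n → Bool, bz r ∈ kerSet n A → D s r zeroVec = (univ.filter fun i => ℓ i && r i).card.bodd)
      ⟨fun r _ y => T_zero_left D hD r y, zeroVec, zeroVec_mem_spanV U, fun r _ => ?_⟩ (fun s hs => ⟨?_, ?_⟩) (fun a b ha hb => ⟨?_, ?_⟩)
    · rw [D_zero_left D hD, bdot_comm, bdot_zeroVec]
    · exact ker_stackOf_sub_rad D hD hg hg3 hs A (fun _ h => h)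
    · refine ⟨_, hmem _ (List.mem_append_right _ (List.mem_map.2 ⟨s, hs, rfl⟩)), fun r hr => ?_⟩
      exact (bd_dualOf_eq D hD hg s A (ker_stackOf_sub_rad D hD hg hg3 hs A (fun _ h => h)) r hr).symm
    · intro r hr y
      rw [T_bxor1 D hD hg3, ha.1 r hr y, hb.1 r hr y]; rfl
    · obtain ⟨ℓa, hℓa, ha'⟩ := ha.2
      obtain ⟨ℓb, hℓb, hb'⟩ := hb.2
      refine ⟨bxor ℓa ℓb, bxor_mem_spanV hℓa hℓb, fun r hr => ?_⟩
      rw [D0_bxor_left D hD, ha.1 r hr b, ha' r hr, hb' r hr, Bool.xor_false, bdot_bxor_left]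
  -- upgrade from `K` to `rad B_s`
  intro s hs
  obtain ⟨hT, ℓ, hℓU, hℓ⟩ := hQ s hs
  set R : Finset (Fin n → Bool) := univ.filter fun r => ∀ y z : Fin n → Bool, (D s r z ^^ D s r (bxor z y)) = false with hR
  have hR0 : zeroVec ∈ R := mem_filter.2 ⟨mem_univ _, fun y z => by rw [D_zero_right D hD, D_zero_right D hD]; rfl⟩
  have hRT : ∀ r ∈ R, ∀ y, (D s r zeroVec ^^ D s r y) = false := fun r hr => (inRad_iff D hD hg3 s r).1 (mem_filter.1 hr).2
  have hRadd : ∀ r ∈ R, ∀ r' ∈ R, bxor r r' ∈ R := by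
    intro r hr r' hr'
    refine mem_filter.2 ⟨mem_univ _, (inRad_iff D hD hg3 s _).2 fun y => ?_⟩
    rw [T_bxor2 D hD hg3, hRT r hr y, hRT r' hr' y]; rfl
  have hlam : ∀ r ∈ R, ∀ r' ∈ R, D s (bxor r r') zeroVec = (D s r zeroVec ^^ D s r' zeroVec) := by
    intro r hr r' _
    rw [D0_bxor_right D hD, hRT r hr r', Bool.xor_false]
  obtain ⟨ℓ', hℓ'⟩ := MPair.exists_repr_of_additive hR0 hRadd (fun r => D s r zeroVec) hlam
  have hKR : ∀ r : Fin n → Bool, bz r ∈ kerSet n A → r ∈ R := fun r hr =>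
    mem_filter.2 ⟨mem_univ _, (inRad_iff D hD hg3 s r).2 (hT r hr)⟩
  have hagree : ∀ r : Fin n → Bool, bz r ∈ kerSet n A → (univ.filter fun i => bxor ℓ' ℓ i && r i).card.bodd = false := by
    intro r hr
    rw [bdot_bxor_left, ← hℓ' r (hKR r hr), ← hℓ r hr, Bool.xor_self]
  have hdiff : bxor ℓ' ℓ ∈ spanV n U :=
    spanV_subset_of_rows (zeroVec_mem_spanV U) (fun _ hx _ hy => bxor_mem_spanV hx hy)
      (fun x hx => stackOf_rows_mem D hD hg hrows (fun s hs => toInput_mem_spanV hs) hx) (mem_spanV_of_orth_ker hagree)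
  have heq : ℓ' = bxor (bxor ℓ' ℓ) ℓ := by
    show ℓ' = (ℓ' + ℓ) + ℓ
    rw [add_assoc, show ℓ + ℓ = 0 from bxor_self ℓ, add_zero]
  refine ⟨ℓ', heq ▸ bxor_mem_spanV hdiff hℓU, fun r hr => hℓ' r (mem_filter.2 ⟨mem_univ _, hr⟩)⟩

end Closed

/-! ### The orthogonality check -/

/-- **The orthogonality check is orthogonality of the spans.** [folklore] -/
theorem orthChk_eq_true_iff (S U : Mat) :
    orthChk n S U = true ↔ ∀ s ∈ spanV n S, ∀ u ∈ spanV n U, (univ.filter fun i => s i && u i).card.bodd = false := by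
  rw [orthChk, List.all_eq_true]
  constructor
  · intro h
    have hrows : ∀ s ∈ S, ∀ u ∈ U, (univ.filter fun i => toInput n s i && toInput n u i).card.bodd = false := by
      intro s hs u hu
      have := h (s, u) (List.pair_mem_product.2 ⟨hs, hu⟩)
      rwa [Bool.not_eq_true', dotL_eq_bd] at this
    refine spanV_induction (P := fun s => ∀ u ∈ spanV n U, (univ.filter fun i => s i && u i).card.bodd = false)
      (fun u _ => by rw [bdot_comm]; exact bdot_zeroVec u) (fun s hs => ?_) (fun a b ha hb u hu => ?_)
    · refine spanV_induction (P := fun u => (univ.filter fun i => toInput n s i && u i).card.bodd = false)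
        (bdot_zeroVec _) (hrows s hs) (fun a b ha hb => ?_)
      rw [bdot_bxor_right, ha, hb]; rfl
    · rw [bdot_bxor_left, ha u hu, hb u hu]; rfl
  · intro h p hp
    obtain ⟨hs, hu⟩ := List.pair_mem_product.1 (show (p.1, p.2) ∈ S.product U from hp)
    rw [Bool.not_eq_true', dotL_eq_bd]
    exact h _ (toInput_mem_spanV hs) _ (toInput_mem_spanV hu)

/-- **The orthogonality check is orthogonality of the spans** (registered brick `grow_orthChkIff` of stub `stub_growFinder`, line `dual-pingpong-frame`, crux stmt-QuantumAdvantage-13932). [folklore] -/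
theorem grow_orthChkIff : ∀ {n : ℕ} (S U : List (List Bool)), orthChk n S U = true ↔ ∀ s ∈ MMReadout.spanV n S, ∀ u ∈ MMReadout.spanV n U, ((Finset.univ.filter fun i => s i && u i).card).bodd = false :=
  fun S U => orthChk_eq_true_iff S U

/-! ## The candidate space (file VI merged) -/


/-! ### The kernel of the candidate rows -/

section Kernel

include hD hg hg3

omit hD hg hg3 in
/-- Orthogonality to the rows of `U` is orthogonality to `span U`. [folklore] -/
theorem bz_mem_kerSet_rows_iff (U : Mat) (v : Fin n → Bool) :
    bz v ∈ kerSet n U ↔ ∀ u ∈ spanV n U, (univ.filter fun i => u i && v i).card.bodd = false := by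
  rw [bz_mem_kerSet_iff]
  refine ⟨fun h => spanV_induction (P := fun u => (univ.filter fun i => u i && v i).card.bodd = false) ?_ h ?_,
    fun h r hr => h _ (toInput_mem_spanV hr)⟩
  · rw [bdot_comm]; exact bdot_zeroVec v
  · intro a b ha hb; rw [bdot_bxor_left, ha, hb]; rfl

/-- **The kernel of the candidate rows is the candidate space** `Z_g(S) ∩ (span U)^⊥ ∩ ⋂ⱼ rad B_{xⱼ}`.
[cite: Carlet2020, §2.2.2] -/
theorem bz_mem_kerSet_candK_iff (S U xs : Mat) (v : Fin n → Bool) :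
    bz v ∈ kerSet n (candK n cg S U xs) ↔
      (∀ s ∈ spanV n S, ∀ x, D s v x = false) ∧
      (∀ u ∈ spanV n U, (univ.filter fun i => u i && v i).card.bodd = false) ∧
      (∀ x ∈ xs, ∀ y z : Fin n → Bool, (D (toInput n x) v z ^^ D (toInput n x) v (bxor z y)) = false) := by
  have hsub : ∀ d, d ∈ kerSet n (candA n cg S U xs) → d ∈ kerSet n (stackOf n cg S) := fun d hd =>
    (mem_kerSet_append.1 (mem_kerSet_append.1 hd).1).1
  -- the offsets pair with kernel vectors of `candA` to `D_s D_v g (0)`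
  have hoff : ∀ s ∈ S, ∀ r : Fin n → Bool, bz r ∈ kerSet n (candA n cg S U xs) →
      (univ.filter fun i => toInput n (dualOf n cg s (rrun n (kerOf n (candA n cg S U xs)))) i && r i).card.bodd =
        D (toInput n s) r zeroVec := fun s hs r hr =>
    bd_dualOf_eq D hD hg s _ (ker_stackOf_sub_rad D hD hg hg3 hs _ hsub) r hr
  have hAiff : bz v ∈ kerSet n (candA n cg S U xs) ↔
      ((∀ s ∈ S, ∀ y, (D (toInput n s) v zeroVec ^^ D (toInput n s) v y) = false) ∧
        (∀ u ∈ spanV n U, (univ.filter fun i => u i && v i).card.bodd = false)) ∧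
      (∀ x ∈ xs, ∀ y, (D (toInput n x) v zeroVec ^^ D (toInput n x) v y) = false) := by
    rw [candA, mem_kerSet_append, mem_kerSet_append, bz_mem_kerSet_stackOf_iff D hD hg hg3, bz_mem_kerSet_stackOf_iff D hD hg hg3,
      bz_mem_kerSet_rows_iff]
  rw [candK, mem_kerSet_append, hAiff]
  constructor
  · rintro ⟨⟨⟨hS, hU⟩, hxs⟩, hoffs⟩
    have hA : bz v ∈ kerSet n (candA n cg S U xs) := hAiff.2 ⟨⟨hS, hU⟩, hxs⟩
    have hbeta : ∀ s ∈ S, D (toInput n s) v zeroVec = false := by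
      intro s hs
      rw [← hoff s hs v hA]
      exact (bz_mem_kerSet_iff _ v).1 hoffs _ (List.mem_map.2 ⟨s, hs, rfl⟩)
    refine ⟨?_, hU, fun x hx => (inRad_iff D hD hg3 _ v).2 (hxs x hx)⟩
    have key : ∀ s ∈ spanV n S, (∀ y, (D s v zeroVec ^^ D s v y) = false) ∧ D s v zeroVec = false := by
      refine spanV_induction (P := fun s => (∀ y, (D s v zeroVec ^^ D s v y) = false) ∧ D s v zeroVec = false)
        ⟨fun y => T_zero_left D hD v y, D_zero_left D hD v _⟩ (fun s hs => ⟨hS s hs, hbeta s hs⟩) (fun a b ha hb => ⟨fun y => ?_, ?_⟩)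
      · rw [T_bxor1 D hD hg3, ha.1 y, hb.1 y]; rfl
      · rw [D0_bxor_left D hD, ha.1 b, ha.2, hb.2]; rfl
    intro s hs x
    rw [D_eq_D0_xor_T D s v x, (key s hs).1 x, (key s hs).2]; rfl
  · rintro ⟨hS, hU, hxs⟩
    have hS' : ∀ s ∈ S, ∀ y, (D (toInput n s) v zeroVec ^^ D (toInput n s) v y) = false := fun s hs y => by
      rw [hS _ (toInput_mem_spanV hs) zeroVec, hS _ (toInput_mem_spanV hs) y]; rfl
    have hxs' : ∀ x ∈ xs, ∀ y, (D (toInput n x) v zeroVec ^^ D (toInput n x) v y) = false := fun x hx =>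
      (inRad_iff D hD hg3 _ v).1 (hxs x hx)
    have hA : bz v ∈ kerSet n (candA n cg S U xs) := hAiff.2 ⟨⟨hS', hU⟩, hxs'⟩
    refine ⟨⟨⟨hS', hU⟩, hxs'⟩, (bz_mem_kerSet_iff _ v).2 fun r hr => ?_⟩
    obtain ⟨s, hs, rfl⟩ := List.mem_map.1 hr
    rw [hoff s hs v hA]
    exact hS _ (toInput_mem_spanV hs) zeroVec

end Kernel

/-! ### The candidate is uniform on the kernel -/

/-- **Uniformity of the kernel parametrisation**: the selectors whose kernel combination lands in `G` number
`2^{#pivots} · |K ∩ G|`, for the kernel finset `K`. [cite: KnuthTAOCP2, §4.6.2 Algorithm N] -/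
theorem card_filter_kcV_mem (M : Mat) {K : Finset (Fin n → Bool)} (hK : ∀ v, v ∈ K ↔ bz v ∈ kerSet n M)
    (G : Finset (Fin n → Bool)) :
    (univ.filter fun w : Fin n → Bool => kcV n (rrun n M) w ∈ G).card = 2 ^ (pivs n (rrun n M)).card * (K.filter fun v => v ∈ G).card := by
  classical
  rw [card_eq_sum_card_fiberwise (f := fun w => kcV n (rrun n M) w) (t := K.filter fun v => v ∈ G) (fun w hw => ?_)]
  · rw [sum_const_nat (m := 2 ^ (pivs n (rrun n M)).card) fun v hv => ?_, mul_comm]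
    obtain ⟨hvK, hvG⟩ := mem_filter.1 hv
    rw [← card_filter_kcV_eq_of_mem M ((hK v).1 hvK)]
    congr 1
    ext w
    simp only [mem_filter, mem_univ, true_and]
    exact ⟨fun h => h.2, fun h => ⟨h ▸ hvG, h⟩⟩
  · have hw' := (mem_filter.1 hw).2
    exact mem_coe.2 (mem_filter.2 ⟨(hK _).2 (by rw [bz_kcV]; exact sum_smul_kvec_mem_kerSet _), hw'⟩)

/-- `2ⁿ = 2^{#pivots} · |K|`. [cite: KnuthTAOCP2, §4.6.2 Algorithm N] -/
theorem two_pow_eq_mul_card_ker (M : Mat) {K : Finset (Fin n → Bool)} (hK : ∀ v, v ∈ K ↔ bz v ∈ kerSet n M) :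
    2 ^ n = 2 ^ (pivs n (rrun n M)).card * K.card := by
  have h := card_filter_kcV_mem M hK univ
  rw [filter_true_of_mem (fun w _ => mem_univ _), card_univ, filter_true_of_mem (fun v _ => mem_univ v)] at h
  rwa [Fintype.card_fun, Fintype.card_bool, Fintype.card_fin] at h

/-- The kernel finset is non-empty (it contains `0`). [folklore] -/
theorem card_ker_pos (M : Mat) {K : Finset (Fin n → Bool)} (hK : ∀ v, v ∈ K ↔ bz v ∈ kerSet n M) : 0 < K.card :=
  card_pos.2 ⟨zeroVec, (hK _).2 (by
    rw [show (zeroVec : Fin n → Bool) = zeroV from rfl, bz_zeroV]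
    intro r _; rw [dotZ_comm]; exact dotZ_zero_left _)⟩

/-- **The good fraction**: the probability over the selector that the kernel combination lands in `G` is
`|K ∩ G| / |K|`. [cite: KnuthTAOCP2, §4.6.2 Algorithm N] -/
theorem card_filter_kcV_div (M : Mat) {K : Finset (Fin n → Bool)} (hK : ∀ v, v ∈ K ↔ bz v ∈ kerSet n M)
    (G : Finset (Fin n → Bool)) :
    ((univ.filter fun w : Fin n → Bool => kcV n (rrun n M) w ∈ G).card : ℝ) / 2 ^ n =
      ((K.filter fun v => v ∈ G).card : ℝ) / K.card := by
  have hK0 : (0 : ℝ) < K.card := by exact_mod_cast card_ker_pos M hK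
  have h2 : (2 : ℝ) ^ n = (2 : ℝ) ^ (pivs n (rrun n M)).card * K.card := by exact_mod_cast two_pow_eq_mul_card_ker M hK
  rw [card_filter_kcV_mem M hK G, h2]
  push_cast
  rw [mul_div_mul_left _ _ (by positivity)]

end Summit.QuantumAdvantage.QuantumAdvantage.Theorems.SignedExactCubicForrelationNotPrBPP.GrowMachine

end
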